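import Summits.Ventures.PercRepro.MSTightConjTAlpha

/-!
# Conjecture (T) in case (β) when a half is tight with a partner top

Dossier proofs/MINE1-theoremS.md, Addendum 45 (supplement 1). Setting: `r` with `P = proj r F`
tight and twin-free; case (β) of the excess split: `X ∩ Y = K ∖∖ K` (`K = partner r F`). On the
census every tightening direction has `F₀ = part0 r F` tight or `F₁ = partr r F` tight. Here:
* if `F₀` is tight and its addable part `R₀ = Rstar F₀` is a partner member, then `Y ⊆ X`
  (`diffsY_subset_diffsX_of_tight_part0`): for `t ∈ F₁` the difference `t ∖ R₀` lies in `X ∩ Y`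
  (`(t ∪ r) ∖ (R₀ ∪ r)` and `(t ∪ r) ∖ R₀`), hence in `K ∖∖ K ⊆ F₀ ∖∖ F₀ = flip R₀ F₀`, which
  forces `t ∪ R₀ ∈ F₀` (`union_Rstar_mem_part0_of_tight`) — a member of `F₀` above `t ∖ s`, and the
  realisation lemma `sdiff_mem_diffsX_of_superset_mem_part0` puts `t ∖ s` into `X`;
* symmetrically, if `F₁` is tight with `R₁ = Rstar F₁ ∈ K`, then `s ∩ R₁ ∈ F₁` for every `s ∈ F₀`
  (`inter_Rstar_mem_partr_of_tight`) and `diffsY_subset_diffsX_of_tight_partr`;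
* with `tightening_split` and the case-(α) theorem: an excess-one family with a tight twin-free
  trace and nonempty partner family has `Y ⊆ X` as soon as a tight half has its addable part in
  `K` (`diffsY_subset_diffsX_of_tight_half`). On the non-monotone case-(β) census this covers
  32,440 of 38,910 configurations; the rest (the tight half's top partnerless) is open.
-/

namespace PercRepro.MSTight

open Finset
open scoped FinsetFamily symmDiff

variable {α : Type*} [DecidableEq α] [Fintype α] {r : α} {F : Finset (Finset α)}

section Part0

variable (hβ : diffsX r F ∩ diffsY r F = partner r F \\ partner r F)
  (h0 : Tight (part0 r F)) (hR : Rstar (part0 r F) ∈ partner r F)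
include hβ h0 hR

omit hβ h0 in
/-- `t ∖ R₀ ∈ X ∩ Y` for every `t ∈ F₁`, when `R₀ ∈ K`. -/
theorem sdiff_Rstar_part0_mem_inter {t : Finset α} (ht : t ∈ partr r F) :
    t \ Rstar (part0 r F) ∈ diffsX r F ∩ diffsY r F := by
  refine mem_inter.2 ⟨?_, mem_diffs.2 ⟨t, ht, _, (mem_inter.1 hR).1, rfl⟩⟩
  exact mem_union.2 (Or.inl (mem_union.2 (Or.inr (mem_diffs.2 ⟨t, ht, _, (mem_inter.1 hR).2, rfl⟩))))

/-- **`t ∪ R₀ ∈ F₀`** for every `t ∈ F₁` (case (β), `F₀` tight, `R₀ ∈ K`). -/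
theorem union_Rstar_mem_part0_of_tight {t : Finset α} (ht : t ∈ partr r F) :
    t ∪ Rstar (part0 r F) ∈ part0 r F := by
  set R := Rstar (part0 r F) with hRdef
  have h1 : t \ R ∈ partner r F \\ partner r F := by
    rw [← hβ]; exact sdiff_Rstar_part0_mem_inter hR ht
  have h2 : t \ R ∈ part0 r F \\ part0 r F :=
    diffs_subset (inter_subset_left) (inter_subset_left) h1
  rw [diffs_eq_flip_of_tight h0] at h2
  obtain ⟨a, ha, haR⟩ := mem_flip.1 h2
  have e : a = t ∪ R := by
    ext x
    have hx := Finset.ext_iff.1 haR x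
    simp only [mem_symmDiff, mem_sdiff, mem_union] at hx ⊢
    tauto
  rwa [e] at ha

/-- **Conjecture (T) in case (β) with `F₀` tight and `R₀ ∈ K`.** -/
theorem diffsY_subset_diffsX_of_tight_part0 (hP : Tight (proj r F))
    (htf : ∀ a b, Twin (proj r F) a b → a = b) : diffsY r F ⊆ diffsX r F := by
  intro z hz
  obtain ⟨t, ht, s, hs, rfl⟩ := mem_diffs.1 hz
  exact sdiff_mem_diffsX_of_superset_mem_part0 hP htf hz
    (union_Rstar_mem_part0_of_tight hβ h0 hR ht) (sdiff_subset.trans subset_union_left)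

end Part0

section Partr

variable (hβ : diffsX r F ∩ diffsY r F = partner r F \\ partner r F)
  (h1 : Tight (partr r F)) (hR : Rstar (partr r F) ∈ partner r F)
include hβ h1 hR

omit hβ h1 in
/-- `R₁ ∖ s ∈ X ∩ Y` for every `s ∈ F₀`, when `R₁ ∈ K`. -/
theorem Rstar_partr_sdiff_mem_inter {s : Finset α} (hs : s ∈ part0 r F) :
    Rstar (partr r F) \ s ∈ diffsX r F ∩ diffsY r F := by
  refine mem_inter.2 ⟨?_, mem_diffs.2 ⟨_, (mem_inter.1 hR).2, s, hs, rfl⟩⟩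
  exact mem_union.2 (Or.inl (mem_union.2 (Or.inl (mem_diffs.2 ⟨_, (mem_inter.1 hR).1, s, hs, rfl⟩))))

/-- **`s ∩ R₁ ∈ F₁`** for every `s ∈ F₀` (case (β), `F₁` tight, `R₁ ∈ K`). -/
theorem inter_Rstar_mem_partr_of_tight {s : Finset α} (hs : s ∈ part0 r F) :
    s ∩ Rstar (partr r F) ∈ partr r F := by
  set R := Rstar (partr r F) with hRdef
  have h2 : R \ s ∈ partner r F \\ partner r F := by
    rw [← hβ]; exact Rstar_partr_sdiff_mem_inter hR hs
  have h3 : R \ s ∈ partr r F \\ partr r F :=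
    diffs_subset (inter_subset_right) (inter_subset_right) h2
  rw [diffs_eq_flip_of_tight h1] at h3
  obtain ⟨b, hb, hbR⟩ := mem_flip.1 h3
  have e : b = s ∩ R := by
    ext x
    have hx := Finset.ext_iff.1 hbR x
    simp only [mem_symmDiff, mem_sdiff, mem_inter] at hx ⊢
    tauto
  rwa [e] at hb

/-- **Conjecture (T) in case (β) with `F₁` tight and `R₁ ∈ K`.** -/
theorem diffsY_subset_diffsX_of_tight_partr (hP : Tight (proj r F))
    (htf : ∀ a b, Twin (proj r F) a b → a = b) : diffsY r F ⊆ diffsX r F := by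
  intro z hz
  obtain ⟨t, ht, s, hs, rfl⟩ := mem_diffs.1 hz
  refine sdiff_mem_diffsX_of_disjoint_mem_partr hP htf hz
    (inter_Rstar_mem_partr_of_tight hβ h1 hR hs) ?_
  rw [Finset.disjoint_left]
  intro x hx hx'
  exact (mem_sdiff.1 hx).2 (mem_inter.1 hx').1

end Partr

section Assembly

/-- **Conjecture (T) for an excess-one family with a tight twin-free trace and nonempty partner
family, whenever a tight half has its addable part among the partner members** — case (α) by
`diffsY_subset_diffsX_of_tight_partner`, case (β) by the two theorems above. -/
theorem diffsY_subset_diffsX_of_tight_half (hF : (F \\ F).card = F.card + 1)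
    (hP : Tight (proj r F)) (htf : ∀ a b, Twin (proj r F) a b → a = b)
    (hK : (partner r F).Nonempty)
    (hhalf : (Tight (part0 r F) ∧ Rstar (part0 r F) ∈ partner r F) ∨
      (Tight (partr r F) ∧ Rstar (partr r F) ∈ partner r F)) :
    diffsY r F ⊆ diffsX r F := by
  rcases tightening_split hF hP with ⟨hT, e, he, hXY⟩ | ⟨_, hβ, _, _⟩
  · exact diffsY_subset_diffsX_of_tight_partner hP htf hT hK he hXY
  · rcases hhalf with ⟨h0, hR⟩ | ⟨h1, hR⟩
    · exact diffsY_subset_diffsX_of_tight_part0 hβ h0 hR hP htf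
    · exact diffsY_subset_diffsX_of_tight_partr hβ h1 hR hP htf

end Assembly

end PercRepro.MSTight
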